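import Literature.Computability.Complexity.PaulPippengerSzemerediTrotter1983Claims
import HarnessLib

/-!
# The true block summaries pass the local checks: completeness of the four-alternation re-simulation (PPST 1983, §3)

Literature / complexity toolkit, eleventh brick of the inline formalization of
Paul–Pippenger–Szemerédi–Trotter 1983 (`PaulPippengerSzemerediTrotter1983.lean`, fact
`PaulEtAl1983_NTIME_not_subset_DTIME`; roadmap Layer 4, mathematical core, part 4). Companion of
`…Claims.lean` (soundness): the HONEST existential player, who claims for every time block its true
summary `trueClaims tm c₀ b j` — true control and heights at the block's start, true extreme
boundary heights, true contents above the block's cut at its start and end —, passes the three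
local checks (C0) `CondInit`, (C1) `CondSim`, (C2) `CondDep`. With `…Claims.lean` this closes the
machine-free core of the `Σ₄` simulation: the local checks hold of a family of claims if and only
if it is the truth (up to the unchecked fields of the last block).

* `TM2Blocks.trueClaims tm c₀ b` — the true summaries; `loC_trueClaims`, `hiC_trueClaims`,
  `cutC_trueClaims`;
* `true_run_eq_append` — across block `j` the true run is the truncated run from the true start
  summary with the true bottoms appended (`TM2Frames.run_append`, room from `minH`);
* **`condInit_trueClaims`**, **`condSim_trueClaims`**, **`condDep_trueClaims`** — completeness.

No named fact is introduced (definitions with bodies and theorems only).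

## References

* W. J. Paul, N. Pippenger, E. Szemerédi, W. T. Trotter, *On determinism versus non-determinism
  and related problems*, FOCS 1983, 429–438, §3 [PaulEtAl1983].
* R. Santhanam, *On separators, segregators and time versus space*, CCC 2001, §1–2
  [Santhanam2001].
-/

namespace Literature.Computability.Complexity

open Turing Function

namespace TM2Blocks

variable {tm : FinTM2}

/-- **The true summaries** of the time blocks of the run from `c₀` with block length `b`.
[cite: PaulEtAl1983, §3] -/
noncomputable def trueClaims (tm : FinTM2) (c₀ : tm.Cfg) (b : ℕ) : ℕ → BlockClaim tm := fun j =>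
  { l := (run tm c₀ (j * b)).l
    var := (run tm c₀ (j * b)).var
    ht := fun k => ((run tm c₀ (j * b)).stk k).length
    mn := fun k => minH tm c₀ b k j
    mx := fun k => maxH tm c₀ b k j
    frag := fun k => above (lo tm c₀ b k j * blockβ tm b) ((run tm c₀ (j * b)).stk k)
    efrag := fun k => above (lo tm c₀ b k j * blockβ tm b) ((run tm c₀ ((j + 1) * b)).stk k) }

/-- The true claims have the true `lo`. [folklore] -/
@[simp] theorem loC_trueClaims (c₀ : tm.Cfg) (b j : ℕ) (k : tm.K) :
    (trueClaims tm c₀ b j).loC b k = lo tm c₀ b k j := rfl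

/-- The true claims have the true `hi`. [folklore] -/
@[simp] theorem hiC_trueClaims (c₀ : tm.Cfg) (b j : ℕ) (k : tm.K) :
    (trueClaims tm c₀ b j).hiC b k = hi tm c₀ b k j := rfl

/-- The true claims have the true cut. [folklore] -/
@[simp] theorem cutC_trueClaims (c₀ : tm.Cfg) (b j : ℕ) (k : tm.K) :
    (trueClaims tm c₀ b j).cutC b k = lo tm c₀ b k j * blockβ tm b := rfl

/-- The cut of block `j` is below the height at its start. [folklore] -/
theorem cut_le_length (c₀ : tm.Cfg) (b j : ℕ) (k : tm.K) :
    lo tm c₀ b k j * blockβ tm b ≤ ((run tm c₀ (j * b)).stk k).length := by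
  have h0 := height_block_ge_minH c₀ b k j 0 (Nat.zero_le _)
  rw [Nat.add_zero] at h0
  rcases Nat.eq_zero_or_pos (lo tm c₀ b k j) with hz | hz
  · rw [hz]; simp
  · have := loβ_add_le_minH c₀ b k j hz; omega

/-- **Across block `j` the true run is the truncated run from the true start summary with the true
bottoms appended.** [cite: PaulEtAl1983, §3] -/
theorem true_run_eq_append (c₀ : tm.Cfg) (b j : ℕ) :
    letI := tm.kDecidableEq
    ∀ t, t ≤ b → run tm c₀ (j * b + t) =
      TM2Frames.appendBot (fun k => below (lo tm c₀ b k j * blockβ tm b) ((run tm c₀ (j * b)).stk k))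
        (run tm (trueClaims tm c₀ b j).startCfg t) := by
  letI := tm.kDecidableEq
  intro t ht
  set d := run tm c₀ (j * b) with hd
  set L : ∀ k, List (tm.Γ k) := fun k => below (lo tm c₀ b k j * blockβ tm b) (d.stk k) with hLdef
  have hL : ∀ k, (L k).length = lo tm c₀ b k j * blockβ tm b := fun k =>
    length_below (cut_le_length c₀ b j k)
  have hsplit : d = TM2Frames.appendBot L (trueClaims tm c₀ b j).startCfg :=
    eq_appendBot_split d (fun k => lo tm c₀ b k j * blockβ tm b)
  have hroom : ∀ t, t < b → ∀ k, L k ≠ [] →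
      TM2Comp.machinePopBound tm + (L k).length ≤
        ((run tm (TM2Frames.appendBot L (trueClaims tm c₀ b j).startCfg) t).stk k).length := by
    intro t ht' k hk
    rw [← hsplit, hd, ← run_add]
    have hpos : 0 < lo tm c₀ b k j := by
      by_contra h0
      have h0 : lo tm c₀ b k j = 0 := by omega
      apply hk
      apply List.eq_nil_of_length_eq_zero
      rw [hL, h0]; simp
    have h1 := loβ_add_le_minH c₀ b k j hpos
    have h2 := height_block_ge_minH c₀ b k j t ht'.le
    rw [hL]; omega
  rw [run_add, ← hd, hsplit]
  exact TM2Frames.run_append _ L b hroom t ht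

/-- **(C0) holds of the true claims.** [cite: PaulEtAl1983, §3] -/
theorem condInit_trueClaims (c₀ : tm.Cfg) (b : ℕ) : CondInit c₀ b (trueClaims tm c₀ b) := by
  refine ⟨?_, ?_, fun k => ?_, fun k => ?_⟩ <;> simp [trueClaims, run, BlockClaim.cutC, BlockClaim.loC, lo]

/-- **(C1) holds of the true claims**: the truncated re-simulation of block `j` from its true start
summary reproduces its true end summary, extreme heights, and the next block's start control and
heights. [cite: PaulEtAl1983, §3] -/
theorem condSim_trueClaims (c₀ : tm.Cfg) (b j : ℕ) : CondSim b (trueClaims tm c₀ b) j := by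
  letI := tm.kDecidableEq
  have htrue := true_run_eq_append c₀ b j
  have hL : ∀ k, (below (lo tm c₀ b k j * blockβ tm b) ((run tm c₀ (j * b)).stk k)).length =
      lo tm c₀ b k j * blockβ tm b := fun k => length_below (cut_le_length c₀ b j k)
  -- heights across the block
  have hlen : ∀ t, t ≤ b → ∀ k, ((run tm c₀ (j * b + t)).stk k).length =
      ((run tm (trueClaims tm c₀ b j).startCfg t).stk k).length + lo tm c₀ b k j * blockβ tm b := by
    intro t ht k
    rw [htrue t ht, TM2Frames.appendBot_stk, List.length_append, hL]
  have hend := htrue b le_rfl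
  rw [show j * b + b = (j + 1) * b by ring] at hend
  refine ⟨fun k => ?_, fun k _ => ?_, ⟨?_, ?_⟩, fun k => ?_, fun k => ?_, fun k => ?_, fun k => ?_⟩
  · -- (a)
    simp only [trueClaims, length_above]
    have := cut_le_length c₀ b j k
    show ((run tm c₀ (j * b)).stk k).length - lo tm c₀ b k j * blockβ tm b +
      lo tm c₀ b k j * blockβ tm b = ((run tm c₀ (j * b)).stk k).length
    omega
  · -- (r)
    have hpos : 0 < lo tm c₀ b k j := by simpa using ‹0 < (trueClaims tm c₀ b j).loC b k›
    have h1 := loβ_add_le_minH' c₀ b k j hpos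
    have h2 := height_block_ge_minH c₀ b k j 0 (Nat.zero_le _)
    rw [Nat.add_zero] at h2
    show _ ≤ (above (lo tm c₀ b k j * blockβ tm b) ((run tm c₀ (j * b)).stk k)).length
    rw [length_above]
    omega
  · -- (b) label
    show (run tm c₀ ((j + 1) * b)).l = _
    rw [hend]; rfl
  · -- (b) state
    show (run tm c₀ ((j + 1) * b)).var = _
    rw [hend]; rfl
  · -- (c)
    show ((run tm c₀ ((j + 1) * b)).stk k).length = _ + lo tm c₀ b k j * blockβ tm b
    have := hlen b le_rfl k
    rwa [show j * b + b = (j + 1) * b by ring] at this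
  · -- (d)
    show above (lo tm c₀ b k j * blockβ tm b) ((run tm c₀ ((j + 1) * b)).stk k) = _
    rw [hend, TM2Frames.appendBot_stk]
    have happ := above_append ((run tm (trueClaims tm c₀ b j).startCfg b).stk k)
      (below (lo tm c₀ b k j * blockβ tm b) ((run tm c₀ (j * b)).stk k))
    rwa [hL k] at happ
  · -- (e)
    simp only [cutC_trueClaims]
    refine ⟨fun t ht => ?_, ?_, fun t ht => ?_, ?_⟩
    · show minH tm c₀ b k j ≤ _
      have := minH_le_height c₀ b k j t ht
      unfold height at this
      rw [hlen t ht k] at this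
      omega
    · obtain ⟨t₀, ht₀, h₀⟩ := Finset.exists_mem_eq_inf' (s := Finset.range (b + 1)) (by simp)
        (fun d => height tm c₀ k (j * b + d))
      simp only [Finset.mem_range] at ht₀
      refine ⟨t₀, by omega, ?_⟩
      show minH tm c₀ b k j = _
      unfold minH
      rw [h₀]
      unfold height
      rw [hlen t₀ (by omega) k, Nat.add_comm]
    · show _ ≤ maxH tm c₀ b k j
      have := height_le_maxH c₀ b k j t ht
      unfold height at this
      rw [hlen t ht k] at this
      omega
    · obtain ⟨t₀, ht₀, h₀⟩ := Finset.exists_mem_eq_sup' (s := Finset.range (b + 1)) (by simp)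
        (fun d => height tm c₀ k (j * b + d))
      simp only [Finset.mem_range] at ht₀
      refine ⟨t₀, by omega, ?_⟩
      show maxH tm c₀ b k j = _
      unfold maxH
      rw [h₀]
      unfold height
      rw [hlen t₀ (by omega) k, Nat.add_comm]
  · -- (f)
    show ((run tm c₀ (j * b)).stk k).length ≤ (hi tm c₀ b k j + 1) * blockβ tm b
    have h1 := maxH_add_lt_hi_succ_mul c₀ b k j
    have h2 := length_run_block_le_maxH c₀ b k j 0 (Nat.zero_le _)
    rw [Nat.add_zero] at h2
    omega

/-- **(C2) holds of the true claims**: every height block touched by block `j` carries, at the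
block's start, its content at the end of its last toucher (`bpart_run_eq_of_lastToucher`) or its
initial content (`bpart_run_eq_init_of_lastToucher_none`). [cite: PaulEtAl1983, §3]
[cite: Santhanam2001, §1 (p. 2)] -/
theorem condDep_trueClaims (c₀ : tm.Cfg) (b j : ℕ) : CondDep c₀ b (trueClaims tm c₀ b) j := by
  intro k B hlo hhi
  simp only [loC_trueClaims, hiC_trueClaims, cutC_trueClaims] at hlo hhi ⊢
  have hcut : lo tm c₀ b k j * blockβ tm b ≤ B * blockβ tm b := Nat.mul_le_mul_right _ hlo
  have hL := length_below (cut_le_length c₀ b j k)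
  -- the left-hand side is the true content of `B` at time `j b`
  have lhs : bpartAbove (blockβ tm b) (lo tm c₀ b k j * blockβ tm b) B ((trueClaims tm c₀ b j).frag k) =
      bpart (blockβ tm b) B ((run tm c₀ (j * b)).stk k) := by
    show bpartAbove (blockβ tm b) (lo tm c₀ b k j * blockβ tm b) B
      (above (lo tm c₀ b k j * blockβ tm b) ((run tm c₀ (j * b)).stk k)) = _
    conv_rhs => rw [← above_append_below (lo tm c₀ b k j * blockβ tm b) ((run tm c₀ (j * b)).stk k)]
    exact (bpart_append_eq_bpartAbove _ _ hL hcut).symm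
  rw [lhs]
  change _ = match lastToucher (lo tm c₀ b k) (hi tm c₀ b k) j B with
    | some i => bpartAbove (blockβ tm b) (lo tm c₀ b k i * blockβ tm b) B
        (above (lo tm c₀ b k i * blockβ tm b) ((run tm c₀ ((i + 1) * b)).stk k))
    | none => bpart (blockβ tm b) B (c₀.stk k)
  cases hlt : lastToucher (lo tm c₀ b k) (hi tm c₀ b k) j B with
  | none =>
    simp only
    exact bpart_run_eq_init_of_lastToucher_none c₀ b k hlt
  | some i =>
    simp only
    obtain ⟨-, hti, -⟩ := lastToucher_spec hlt
    have hcuti : lo tm c₀ b k i * blockβ tm b ≤ B * blockβ tm b := Nat.mul_le_mul_right _ hti.1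
    have hθle' : lo tm c₀ b k i * blockβ tm b ≤ ((run tm c₀ ((i + 1) * b)).stk k).length := by
      have h1 := height_block_ge_minH c₀ b k i b le_rfl
      rw [show i * b + b = (i + 1) * b by ring] at h1
      rcases Nat.eq_zero_or_pos (lo tm c₀ b k i) with hz | hz
      · rw [hz]; simp
      · have := loβ_add_le_minH c₀ b k i hz; omega
    have hL' := length_below hθle'
    rw [bpart_run_eq_of_lastToucher c₀ b k hlt]
    conv_lhs => rw [← above_append_below (lo tm c₀ b k i * blockβ tm b)
      ((run tm c₀ ((i + 1) * b)).stk k)]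
    exact bpart_append_eq_bpartAbove _ _ hL' hcuti

end TM2Blocks

end Literature.Computability.Complexity
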